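import Summits.AnomalousDissipation.AnomalousDissipation.Theorems.BaireTransferRobustLoudUpgradeLineUnfoldingDefs

/-!
# Line `malkin-cone-group-orbits`, companion c6: the EXACT residual of the crux `BaireTransfer.RobustLoudUpgrade`
# (stmt-AnomalousDissipation-1144) and the tame-density bypass of the route target

Pure topology over the landed glue `Unfolding.tameUnfold_subset_closure_interior_loud` (the maximal tame union of the seats
v2–v5/c1–c5 — nondegenerate and persistent steady witnesses on every conserved-mean leaf, the strict window census,
Lyapunov–Schmidt crossings, robust crossings, subharmonic pitchforks, folds, indefinite (cone) points, Malkin cones and bordered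
persistence of steady and of time-periodic witnesses, invisible saddles of cycles, scaling crossings, radial folds in the
Reynolds number, near-persistence and intrinsic `(ν, m)`-unfoldings — lies in `closure (interior LOUD)` at the same strict
budgets).  Three statements, no new definitions:

* `RobustLoudUpgrade_iff_wild`: the crux is EQUIVALENT to its WILD RESIDUAL — the same inclusion asked only of the loud forces
  that are NOT limits of tame-witnessed forces at the relaxed budgets,
  `LOUD_j(S,E,ε) \ closure (tameUnfold_j(S,2E,ε/2)) ⊆ closure (interior LOUD_j(S,2E,ε/2))`.
  (The registered residual `stub_residual_c5 : loud ⊆ closure (tameUnfold (2E) (ε/2))` is sufficient but strictly stronger in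
  form: an interior point of `LOUD₂` need not be a limit of tame-witnessed forces.)  This is the statement the lead c6 registers as
  `stub_residual_c6` and hands back: after five seats the remainder of the crux is, provably, the crux itself restricted to
  totally rigid ("wild") loud witnesses — isolated witnesses of Leray–Schauder index `0` invisible to every available unfolding.
* `residual_c6_of_c5`: the c5 residual implies the wild residual (so nothing already registered is lost).
* `baireTarget_of_dense_tame`: the route target `BaireTarget` follows from DENSITY OF TAME-LOUD forces in some open `U` at every
  level, with no upgrade crux at all — the typed alternative for the planners (ask crux #2 of witnesses carrying any landed local
  certificate; every known construction of loud orbits — hyperbolic periodic orbits, implicit-function continuation — delivers one).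

References: the route file `Theses/BaireTransfer.lean` (items 1143–1145); `Theorems/BaireTransferRobustLoudUpgradeLineUnfoldingDefs.lean`
(classes and glue); `Cruxes/RobustLoudUpgrade/NOTES-c4.md` §3, `NOTES-c5.md` (recommendations this file makes precise).
-/

-- `Summit.<Summit>.<Problem>` is the tree's mandated summit-side namespace (CONVENTIONS §2); for this
-- single-conjunct summit the two coincide, so the duplicate is deliberate.
set_option linter.dupNamespace false

noncomputable section

open scoped Topology
open Filter Set Function TopologicalSpace

namespace Summit.AnomalousDissipation.AnomalousDissipation.Theorems.RobustLoudUpgrade.WildResidual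

open Summit.AnomalousDissipation.AnomalousDissipation.Theses.BaireTransfer
open Summit.AnomalousDissipation.AnomalousDissipation.Theorems.RobustLoudUpgrade.Unfolding

/-! ## §1 The topological engine -/

/-- **Splitting an upgrade along a tame part** (pure topology): if `T ⊆ closure (interior L₂)` and the inclusion
`L ⊆ closure (interior L₂)` holds off `closure T`, it holds on all of `L`. [folklore] -/
theorem subset_closure_interior_of_diff {X : Type*} [TopologicalSpace X] {L L₂ T : Set X}
    (hT : T ⊆ closure (interior L₂)) (hW : L \ closure T ⊆ closure (interior L₂)) :
    L ⊆ closure (interior L₂) := by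
  intro c hc
  by_cases h : c ∈ closure T
  · exact closure_minimal hT isClosed_closure h
  · exact hW ⟨hc, h⟩

/-- **Density of a tame part gives the target inclusion** (pure topology): if `T ⊆ closure (interior L)` and `U ⊆ closure T`,
then `U ⊆ closure (interior L)`. [folklore] -/
theorem subset_closure_interior_of_dense {X : Type*} [TopologicalSpace X] {L T U : Set X}
    (hT : T ⊆ closure (interior L)) (hU : U ⊆ closure T) : U ⊆ closure (interior L) :=
  hU.trans (closure_minimal hT isClosed_closure)

/-! ## §2 The crux is equivalent to its wild residual -/

/-- **The wild residual proves the crux** (any stock `S₀`): if at every level the loud forces that are NOT limits of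
tame-witnessed forces at the relaxed budgets lie in `closure (interior LOUD₂)`, then `RobustLoudUpgrade` holds — the tame ones do
by the landed glue `tameUnfold_subset_closure_interior_loud`. [folklore] -/
theorem RobustLoudUpgrade_of_wild (S₀ : Finset (Fin 3 → ℤ))
    (h : ∀ S : Finset (Fin 3 → ℤ), S₀ ⊆ S → ∀ (E ε : ℝ), 0 < ε → ∀ j : ℕ,
      loud S (1 / ((j : ℝ) + 1)) E ε \ closure (tameUnfold S (1 / ((j : ℝ) + 1)) (2 * E) (ε / 2)) ⊆
        closure (interior (loud S (1 / ((j : ℝ) + 1)) (2 * E) (ε / 2)))) :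
    RobustLoudUpgrade :=
  ⟨S₀, fun S hS E ε hε j =>
    subset_closure_interior_of_diff (tameUnfold_subset_closure_interior_loud S _ _ _) (h S hS E ε hε j)⟩

/-- **The crux implies its wild residual** (with the crux's own stock). [folklore] -/
theorem wild_of_RobustLoudUpgrade (h : RobustLoudUpgrade) :
    ∃ S₀ : Finset (Fin 3 → ℤ), ∀ S : Finset (Fin 3 → ℤ), S₀ ⊆ S → ∀ (E ε : ℝ), 0 < ε → ∀ j : ℕ,
      loud S (1 / ((j : ℝ) + 1)) E ε \ closure (tameUnfold S (1 / ((j : ℝ) + 1)) (2 * E) (ε / 2)) ⊆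
        closure (interior (loud S (1 / ((j : ℝ) + 1)) (2 * E) (ε / 2))) := by
  obtain ⟨S₀, hS₀⟩ := h
  exact ⟨S₀, fun S hS E ε hε j => fun c hc => hS₀ S hS E ε hε j hc.1⟩

/-- **The exact residual.**  `RobustLoudUpgrade` is EQUIVALENT to its wild residual: the crux's inclusion asked only of the loud
forces outside the closure of the maximal tame union at the relaxed budgets.  After the seats v2–c5 what remains of the crux is,
provably, the crux on totally rigid loud witnesses; nothing weaker closes it and nothing stronger is needed. [folklore] -/
theorem RobustLoudUpgrade_iff_wild :
    RobustLoudUpgrade ↔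
      ∃ S₀ : Finset (Fin 3 → ℤ), ∀ S : Finset (Fin 3 → ℤ), S₀ ⊆ S → ∀ (E ε : ℝ), 0 < ε → ∀ j : ℕ,
        loud S (1 / ((j : ℝ) + 1)) E ε \ closure (tameUnfold S (1 / ((j : ℝ) + 1)) (2 * E) (ε / 2)) ⊆
          closure (interior (loud S (1 / ((j : ℝ) + 1)) (2 * E) (ε / 2))) :=
  ⟨wild_of_RobustLoudUpgrade, fun ⟨S₀, h⟩ => RobustLoudUpgrade_of_wild S₀ h⟩

/-- **Nothing registered is lost**: the c5 residual (`stub_residual_c5`, stock `unitStock`, every ceiling `a > 0`) implies the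
wild residual (stock `unitStock`, level ceilings). [folklore] -/
theorem residual_c6_of_c5
    (h5 : ∀ S : Finset (Fin 3 → ℤ), unitStock ⊆ S → ∀ (a E ε : ℝ), 0 < a → 0 < ε →
      loud S a E ε ⊆ closure (tameUnfold S a (2 * E) (ε / 2))) :
    ∃ S₀ : Finset (Fin 3 → ℤ), ∀ S : Finset (Fin 3 → ℤ), S₀ ⊆ S → ∀ (E ε : ℝ), 0 < ε → ∀ j : ℕ,
      loud S (1 / ((j : ℝ) + 1)) E ε \ closure (tameUnfold S (1 / ((j : ℝ) + 1)) (2 * E) (ε / 2)) ⊆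
        closure (interior (loud S (1 / ((j : ℝ) + 1)) (2 * E) (ε / 2))) := by
  refine ⟨unitStock, fun S hS E ε hε j => fun c hc => ?_⟩
  refine (show loud S (1 / ((j : ℝ) + 1)) E ε ⊆ _ from ?_) hc.1
  have ha : (0 : ℝ) < 1 / ((j : ℝ) + 1) := by positivity
  exact (h5 S hS _ E ε ha hε).trans
    (closure_minimal (tameUnfold_subset_closure_interior_loud S _ _ _) isClosed_closure)

/-! ## §3 The tame-density bypass of the route target -/

/-- **BaireTarget from density of tame-loud forces, with no upgrade crux.**  If for some frequency set `S`, budgets `E`, `ε > 0`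
and a non-empty open `U ⊆ P_S` the TAME-loud forces `tameUnfold_j(S,E,ε)` are dense in `U` at every level `j`, then the route
target `BaireTarget` holds (`tameUnfold ⊆ closure (interior LOUD)` at the same budgets, and `closure` is monotone and
idempotent).  The typed alternative to the pair (crux #2 `DenseLoudDesignerForces`, crux #3 `RobustLoudUpgrade`). [folklore] -/
theorem baireTarget_of_dense_tame
    (h : ∃ (S : Finset (Fin 3 → ℤ)) (E ε : ℝ), 0 < ε ∧ ∃ U : Set (Coeff S), IsOpen U ∧ U.Nonempty ∧
      ∀ j : ℕ, U ⊆ closure (tameUnfold S (1 / ((j : ℝ) + 1)) E ε)) :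
    BaireTarget := by
  obtain ⟨S, E, ε, hε, U, hU, hUne, hdense⟩ := h
  exact ⟨S, E, ε, hε, U, hU, hUne, fun j =>
    subset_closure_interior_of_dense (tameUnfold_subset_closure_interior_loud S _ E ε) (hdense j)⟩

/-! ## §4 The registered line glue of the companion c6 -/

/-- **Line glue of the companion c6 (registered sub-goal `line_glue_c6`)**: the wild residual — registered as the sole stub
`stub_residual_c6` of the c6 skeleton `Cruxes/RobustLoudUpgrade/Lines/malkin_cone_group_orbits_c6.lean` — proves the crux
`RobustLoudUpgrade` BY NAME; by `RobustLoudUpgrade_iff_wild` it is also implied by it. [folklore] -/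
theorem line_glue_c6 : (∃ S₀ : Finset (Fin 3 → ℤ), ∀ S : Finset (Fin 3 → ℤ), S₀ ⊆ S → ∀ (E ε : ℝ), 0 < ε → ∀ j : ℕ, loud S (1 / ((j : ℝ) + 1)) E ε \ closure (tameUnfold S (1 / ((j : ℝ) + 1)) (2 * E) (ε / 2)) ⊆ closure (interior (loud S (1 / ((j : ℝ) + 1)) (2 * E) (ε / 2)))) → RobustLoudUpgrade :=
  fun h => RobustLoudUpgrade_iff_wild.2 h

end Summit.AnomalousDissipation.AnomalousDissipation.Theorems.RobustLoudUpgrade.WildResidual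

end
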